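import Mathlib
import HarnessLib

/-!
# Valuation rings étale-local over a discretely valued subfield are generated by a Hensel root

Topic: `Literature/AlgebraicGeometry/Resolution` (valued function fields). Everything here is
PROVED; there are no new definitions.

Let `K / L` be a finite separable extension of fields and `O` a valuation ring of `K` such that
`O_L := O ∩ L` is Noetherian (so `O_L` is a discrete valuation ring or `L`), the maximal ideal of
`O` is generated by an element `t ∈ L` ("`e = 1`"), and the residue field of `O` is separable
over that of `O_L` (here: algebraic over a perfect subfield `k ⊆ O` of `K`). Then `O` is the
localisation `B_𝔓` of the integral closure `B` of `O_L` in `K` at the centre `𝔓 = 𝔪_O ∩ B`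
(`B` is a Dedekind domain, finite over `O_L`), `B` is UNRAMIFIED over `O_L` at `𝔓`
(`Algebra.FormallyUnramified.of_map_maximalIdeal`), hence by the local structure theorem of
unramified algebras (Mathlib's `Algebra.IsUnramifiedAt.exists_hasStandardEtaleSurjectionOn`,
cf. [Stacks 00UE]) some `B[1/f]`, `f ∉ 𝔓`, is a quotient of a standard étale algebra
`O_L[X][Y]/(g, Y h - 1)`, `g` monic. The image `η ∈ O` of `X` is a HENSEL ROOT over `O_L`
(`g(η) = 0`, `g'(η) ∈ O^×`) and `K = L(η)`: this is "`O_F = A_q` for a standard-étale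
`A = O_E[x]_{g(x)}`" of Knaf–Kuhlmann 2005, §5 (p. 12, citing Raynaud, *Anneaux locaux
henséliens*, X Thm. 1 / V Thm. 1) and the implication "(3) ⇒ local-étale ⇒ strongly smoothly
uniformizable" of Knaf–Kuhlmann 2009, Lemma 3.7; its output is exactly the input of the tree
theorem `isSmoothlyUniformizableIn_of_henselRoot` (`LocalEtaleUniformization.lean`).

## Main results (all PROVED)

* `isLocalization_atPrime_valuationSubring_of_isDedekindDomain` — a valuation ring `O` of
  `K = Frac S` containing a Dedekind domain `S` is the localisation of `S` at the centre
  `𝔪_O ∩ S` [folklore].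
* `exists_henselRoot_of_isUnramifiedAt` — if `S ⊆ O`, `Frac S = K`, `S` of finite type over `R`
  and unramified over `R` at the centre of `O`, then `K = Frac(R)(η)` for a Hensel root `η ∈ O`
  of a monic polynomial over `R` (local structure of unramified algebras).
* `exists_henselRoot_generator` — the statement of the first paragraph.

## Sources

* [KK05] H. Knaf, F.-V. Kuhlmann, *Abhyankar places admit local uniformization in any
  characteristic*, Ann. Sci. ÉNS 38 (2005), §5 (p. 12: "`O_F = A_q` for an étale
  `O_E`-algebra `A` […] we can assume that `A` is standard-étale, i.e. `A = O_E[x]_{g(x)}`").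
* [KK09] H. Knaf, F.-V. Kuhlmann, *Every place admits local uniformization in a finite
  extension of the function field*, Adv. Math. 221 (2009), Lemma 3.7 (2), (3) and its proof
  ("`B_{q_B}` is a normal local extension of `O_L` […] thus a valuation domain contained in
  `O_P` […] we get `B_{q_B} = O_P`").
* M. Raynaud, *Anneaux locaux henséliens*, LNM 169 (1970), Ch. V Thm. 1, Ch. X Thm. 1 (as cited
  in [KK05]); The Stacks Project, Tag 00UE and §10.152 (Mathlib's
  `Mathlib.RingTheory.Unramified.LocalStructure`).

## Rendering notes

`O_L` is `O.comap (algebraMap L K) : ValuationSubring L`; "`e = 1`" is rendered by an element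
`t ∈ L` with `v(t) < 1` and `v(y) < 1 → v(y) ≤ v(t)`; the residue condition by a perfect field
`k` with `k ⊆ O` over which every residue of `O` is algebraic (`∀ x ∈ O, ∃ g monic over k,
v(g(x)) < 1`). Values are written multiplicatively (`ValuationSubring.valuation`).
-/

noncomputable section

open IsLocalRing Polynomial

namespace Literature.AlgebraicGeometry.Resolution

/-! ## Valuation rings over a Dedekind domain are localisations at the centre -/

/-- **A valuation ring of `K = Frac S` containing the Dedekind domain `S` is `S_𝔓` for the
centre `𝔓 = 𝔪_O ∩ S`**: `O` is the localisation of `S` at the prime `𝔓` (as an `S`-algebra).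
If `O = K` the centre is `0` and `K = Frac S`; otherwise `𝔓 ≠ 0`, `S_𝔓 ⊆ O` is a discrete
valuation ring of `K`, hence a maximal proper subring (Mathlib's
`ValuationSubring.eq_of_le_of_ne_top`), so `S_𝔓 = O`. (Neukirch, *Algebraic Number Theory*
II §8; proof of Knaf–Kuhlmann 2009 Lemma 3.7 (1).) [folklore] -/
theorem isLocalization_atPrime_valuationSubring_of_isDedekindDomain {S K : Type*} [CommRing S]
    [IsDedekindDomain S] [Field K] [Algebra S K] [IsFractionRing S K] (O : ValuationSubring K)
    [Algebra S O] [IsScalarTower S O K] :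
    IsLocalization.AtPrime O ((maximalIdeal O).comap (algebraMap S O)) := by
  set Q : Ideal S := (maximalIdeal O).comap (algebraMap S O)
  have hSK : ∀ b : S, algebraMap S K b = ((algebraMap S O b : O) : K) := fun b =>
    IsScalarTower.algebraMap_apply S O K b
  have hSO : ∀ b : S, algebraMap S K b ∈ O := fun b => by rw [hSK]; exact (algebraMap S O b).2
  have hQv : ∀ b : S, b ∈ Q ↔ O.valuation (algebraMap S K b) < 1 := fun b => by
    rw [Ideal.mem_comap, ValuationSubring.valuation_lt_one_iff, hSK]
  have hv1 : ∀ b : S, b ∉ Q → O.valuation (algebraMap S K b) = 1 := fun b hb =>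
    le_antisymm ((O.valuation_le_one_iff _).mpr (hSO b)) (not_lt.mp ((hQv b).not.mp hb))
  have hne0 : ∀ b : S, b ∉ Q → algebraMap S K b ≠ 0 := fun b hb h => by
    have h1 := hv1 b hb
    rw [h, Valuation.map_zero] at h1
    exact zero_ne_one h1
  have hinv : ∀ b : S, b ∉ Q → (algebraMap S K b)⁻¹ ∈ O := fun b hb => by
    rw [← O.valuation_le_one_iff, map_inv₀, hv1 b hb, inv_one]
  refine (isLocalization_iff _ _).mpr ⟨?_, fun z => ?_, fun {a b} h => ⟨1, ?_⟩⟩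
  · rintro ⟨b, hb⟩
    rw [ValuationSubring.valuation_eq_one_iff, ← hSK]
    exact hv1 b hb
  · -- `z = a / b` with `b ∉ 𝔓`
    suffices h : ∃ a b : S, b ∉ Q ∧ (z : K) = algebraMap S K a * (algebraMap S K b)⁻¹ by
      obtain ⟨a, b, hb, e⟩ := h
      refine ⟨(a, ⟨b, hb⟩), Subtype.ext ?_⟩
      change (z : K) * ((algebraMap S O b : O) : K) = ((algebraMap S O a : O) : K)
      rw [← hSK, ← hSK, e, inv_mul_cancel_right₀ (hne0 b hb)]
    by_cases hO : O = ⊤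
    · obtain ⟨a, b, hb, e⟩ := IsFractionRing.div_surjective (A := S) (z : K)
      have hb0 : algebraMap S K b ≠ 0 := IsFractionRing.to_map_ne_zero_of_mem_nonZeroDivisors hb
      refine ⟨a, b, fun hbQ => ?_, by rw [← e, div_eq_mul_inv]⟩
      have hmem : (algebraMap S K b)⁻¹ ∈ O := by rw [hO]; exact ValuationSubring.mem_top _
      rw [← O.valuation_le_one_iff, map_inv₀, inv_le_one₀ ((Valuation.pos_iff _).mpr hb0)] at hmem
      exact (not_lt.mpr hmem) ((hQv b).mp hbQ)
    · have hQ0 : Q ≠ ⊥ := by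
        intro hQ0
        apply hO
        refine eq_top_iff.mpr fun x _ => ?_
        obtain ⟨a, b, hb, rfl⟩ := IsFractionRing.div_surjective (A := S) x
        have hb' : b ∉ Q := by rw [hQ0, Ideal.mem_bot]; exact nonZeroDivisors.ne_zero hb
        rw [div_eq_mul_inv]
        exact mul_mem (hSO a) (hinv b hb')
      let w : IsDedekindDomain.HeightOneSpectrum S := ⟨Q, inferInstance, hQ0⟩
      have hle : IsDedekindDomain.HeightOneSpectrum.valuationSubringAtPrime K w ≤ O := by
        rintro x ⟨a, b, hb, rfl⟩
        exact mul_mem (hSO a) (hinv b hb)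
      have heq := ValuationSubring.eq_of_le_of_ne_top _ hle hO
      have hz : (z : K) ∈ IsDedekindDomain.HeightOneSpectrum.valuationSubringAtPrime K w := by
        rw [heq]; exact z.2
      obtain ⟨a, b, hb, e⟩ := hz
      exact ⟨a, b, hb, e⟩
  · have hab : algebraMap S K a = algebraMap S K b := by rw [hSK, hSK, h]
    rw [IsFractionRing.injective S K hab]

/-! ## Hensel-root generators from the local structure of unramified algebras -/

/-- **Local structure of unramified algebras, in Hensel-root form.** Let `O` be a valuation ring
of the field `K`, `S ⊆ O` a subring with `Frac S = K` which is of finite type over `R` and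
UNRAMIFIED over `R` at the centre `𝔓 = 𝔪_O ∩ S` of `O`. Then there is `η ∈ O` with
`K = Frac(R)(η)` (indeed `K` is the subfield generated by the image of `R` and `η`) which is a
HENSEL ROOT over `R`: `f(η) = 0` for a monic `f ∈ R[X]` with `f'(η)` a unit of `O`. Proof: by
Mathlib's `Algebra.IsUnramifiedAt.exists_hasStandardEtaleSurjectionOn` (cf. Stacks 00UE) some
`S[1/f₀]`, `f₀ ∉ 𝔓` — so `S[1/f₀] ⊆ O` —, is a quotient of a standard étale algebra
`R[X][Y]/(f, Y g - 1)`; `η` is the image of `X`, and every element of `S` is `p(η)/g(η)^n`.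
(Knaf–Kuhlmann 2005 §5 p. 12, "`A` standard-étale, i.e. `A = O_E[x]_{g(x)}`", after Raynaud,
*Anneaux locaux henséliens* V Thm. 1.) [cite: KnafKuhlmann2005, Section 5 (p. 12)] -/
theorem exists_henselRoot_of_isUnramifiedAt {R S K : Type*} [CommRing R] [CommRing S] [Field K]
    [Algebra R S] [Algebra S K] [Algebra R K] [IsScalarTower R S K] [IsFractionRing S K]
    [Algebra.FiniteType R S] (O : ValuationSubring K) (hSO : ∀ b : S, algebraMap S K b ∈ O)
    (Q : Ideal S) [Q.IsPrime] (hQ : ∀ b : S, b ∈ Q ↔ O.valuation (algebraMap S K b) < 1)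
    [Algebra.IsUnramifiedAt R Q] :
    ∃ η ∈ O, Subfield.closure (Set.range (algebraMap R K) ∪ {η}) = ⊤ ∧
      ∃ f : R[X], f.Monic ∧ aeval η f = 0 ∧ O.valuation (aeval η (derivative f)) = 1 := by
  obtain ⟨f₀, hf₀Q, P, φ, hφ⟩ :=
    Algebra.IsUnramifiedAt.exists_hasStandardEtaleSurjectionOn (R := R) Q
  -- `S → O` and `S[1/f₀] → O` as `R`-algebra maps
  let ι : S →+* O := (algebraMap S K).codRestrict O hSO
  letI : Algebra R O := (ι.comp (algebraMap R S)).toAlgebra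
  haveI : IsScalarTower R O K :=
    IsScalarTower.of_algebraMap_eq fun r => IsScalarTower.algebraMap_apply R S K r
  let ιA : S →ₐ[R] O := ⟨ι, fun _ => rfl⟩
  have hv1 : O.valuation (algebraMap S K f₀) = 1 :=
    le_antisymm ((O.valuation_le_one_iff _).mpr (hSO f₀)) (not_lt.mp ((hQ f₀).not.mp hf₀Q))
  have hunit : ∀ y : Submonoid.powers f₀, IsUnit (ιA y) := by
    rintro ⟨y, n, rfl⟩
    rw [map_pow]
    refine IsUnit.pow n ?_
    rw [ValuationSubring.valuation_eq_one_iff]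
    exact hv1
  let ψ : Localization.Away f₀ →ₐ[R] O := IsLocalization.liftAlgHom (M := Submonoid.powers f₀) hunit
  let θ : P.Ring →ₐ[R] O := ψ.comp φ
  let θK : P.Ring →ₐ[R] K := (IsScalarTower.toAlgHom R O K).comp θ
  have hX : P.HasMap (θ P.X) := P.hasMap_X.map θ
  have hXK : P.HasMap (θK P.X) := P.hasMap_X.map θK
  set η : K := θK P.X with hη
  have hηO : η ∈ O := (θ P.X).2
  refine ⟨η, hηO, ?_, P.f, P.monic_f, hXK.1, ?_⟩
  · -- generation: `S ⊆ closure (R ∪ {η})` since every `b ∈ S` is `p(η) / g(η)^n`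
    set F := Subfield.closure (Set.range (algebraMap R K) ∪ {η}) with hF
    have hRF : ∀ r : R, algebraMap R K r ∈ F := fun r => Subfield.subset_closure (Or.inl ⟨r, rfl⟩)
    have hηF : η ∈ F := Subfield.subset_closure (Or.inr rfl)
    have haeval : ∀ q : R[X], aeval η q ∈ F := fun q =>
      Polynomial.induction_on' q (fun p q hp hq => by rw [map_add]; exact add_mem hp hq)
        fun n r => by rw [aeval_monomial]; exact mul_mem (hRF r) (pow_mem hηF n)
    have hg0 : aeval η P.g ≠ 0 := by
      intro h0
      have h1 : O.valuation ((aeval (θ P.X) P.g : O) : K) = 1 :=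
        (O.valuation_eq_one_iff _).mp hX.2
      have h2 : ((aeval (θ P.X) P.g : O) : K) = aeval η P.g :=
        (aeval_algebraMap_apply K (θ P.X) P.g).symm
      rw [h2, h0, Valuation.map_zero] at h1
      exact zero_ne_one h1
    let Pr : StandardEtalePresentation R P.Ring :=
      ⟨P, P.X, P.hasMap_X, by simpa [StandardEtalePair.lift_X_left] using Function.bijective_id⟩
    have hSF : ∀ b : S, algebraMap S K b ∈ F := fun b => by
      obtain ⟨π, hπ⟩ := hφ (algebraMap S (Localization.Away f₀) b)
      obtain ⟨q, n, hq⟩ := Pr.exists_mul_aeval_x_g_pow_eq_aeval_x π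
      have e1 : θK π = algebraMap S K b := by
        change ((ψ (φ π) : O) : K) = algebraMap S K b
        rw [hπ, IsLocalization.liftAlgHom_apply, IsLocalization.lift_eq]
        rfl
      have e2 : algebraMap S K b * aeval η P.g ^ n = aeval η q := by
        have h := congrArg θK hq
        rw [map_mul, map_pow] at h
        change θK π * θK (aeval P.X P.g) ^ n = θK (aeval P.X q) at h
        rwa [← aeval_algHom_apply, ← aeval_algHom_apply, e1] at h
      rw [eq_div_of_mul_eq (pow_ne_zero n hg0) e2]
      exact div_mem (haeval q) (pow_mem (haeval P.g) n)
    refine eq_top_iff.mpr fun x _ => ?_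
    obtain ⟨a, b, -, rfl⟩ := IsFractionRing.div_surjective (A := S) x
    exact div_mem (hSF a) (hSF b)
  · have h2 : aeval η (derivative P.f) = ((aeval (θ P.X) (derivative P.f) : O) : K) :=
      aeval_algebraMap_apply K (θ P.X) _
    rw [h2]
    exact (O.valuation_eq_one_iff _).mp hX.isUnit_derivative_f

/-! ## The generator theorem -/

/-- **A valuation ring which is étale-local over a discretely valued subfield is generated by a
Hensel root** (Knaf–Kuhlmann 2009, Lemma 3.7 (3) ⇒ (2) with Knaf–Kuhlmann 2005 §5,
"`O_F = A_q`, `A = O_E[x]_{g(x)}` standard-étale"; Raynaud X Thm. 1). Let `K / L` be finite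
separable, `O` a valuation ring of `K` with `O ∩ L` Noetherian, whose maximal ideal is generated
by some `t ∈ L` (`v(t) < 1`, and `v(y) < 1 ⇒ v(y) ≤ v(t)`: ramification index `1`), and whose
residue field is algebraic over a perfect subfield `k ⊆ O ∩ L` (so that the residue extension
of `O | O ∩ L` is separable). Then `K = L(η)` for some `η ∈ O` which is a root of a monic
polynomial `f` with coefficients in `O ∩ L` such that `f'(η)` is a unit of `O`. Proof: the
integral closure `B` of `O_L = O ∩ L` in `K` is finite over the discrete valuation ring `O_L`
and `O = B_𝔓` (`isLocalization_atPrime_valuationSubring_of_isDedekindDomain`); `𝔪_{O_L} O = 𝔪_O`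
and the residue extension is separable, so `B` is unramified over `O_L` at `𝔓`
(`Algebra.FormallyUnramified.of_map_maximalIdeal`), and `exists_henselRoot_of_isUnramifiedAt`
applies. [cite: KnafKuhlmann2009, Lemma 3.7] -/
theorem exists_henselRoot_generator {k L K : Type*} [Field k] [PerfectField k] [Field L]
    [Field K] [Algebra k L] [Algebra L K] [Algebra k K] [IsScalarTower k L K]
    [FiniteDimensional L K] [Algebra.IsSeparable L K] (O : ValuationSubring K)
    [IsNoetherianRing (O.comap (algebraMap L K))] (hk : ∀ c : k, algebraMap k K c ∈ O)
    (hres : ∀ x : K, x ∈ O → ∃ g : k[X], g.Monic ∧ O.valuation (aeval x g) < 1) {t : L}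
    (hlt : O.valuation (algebraMap L K t) < 1)
    (ht : ∀ y : K, O.valuation y < 1 → O.valuation y ≤ O.valuation (algebraMap L K t)) :
    ∃ η ∈ O, Subfield.closure (Set.range (algebraMap L K) ∪ {η}) = ⊤ ∧
      ∃ f : K[X], f.Monic ∧ (∀ i, f.coeff i ∈ O ∧ f.coeff i ∈ Set.range (algebraMap L K)) ∧
        f.eval η = 0 ∧ O.valuation ((derivative f).eval η) = 1 := by
  set OL : ValuationSubring L := O.comap (algebraMap L K) with hOL
  -- `O_L → O`, a local homomorphism
  let ιR : OL →+* O := ((algebraMap L K).comp OL.subtype).codRestrict O fun r => r.2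
  letI : Algebra OL O := ιR.toAlgebra
  haveI : IsScalarTower OL O K := IsScalarTower.of_algebraMap_eq fun _ => rfl
  haveI : IsScalarTower OL L K := IsScalarTower.of_algebraMap_eq fun _ => rfl
  haveI hloc : IsLocalHom (algebraMap OL O) := ⟨fun r hr => by
    have h1 : O.valuation (algebraMap L K r) = 1 := (O.valuation_eq_one_iff _).mp hr
    have hr0 : (r : L) ≠ 0 := fun h => by
      rw [h, map_zero, Valuation.map_zero] at h1
      exact zero_ne_one h1
    have hinv : (r : L)⁻¹ ∈ OL := by
      change algebraMap L K (r : L)⁻¹ ∈ O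
      rw [map_inv₀, ← O.valuation_le_one_iff, map_inv₀, h1, inv_one]
    exact IsUnit.of_mul_eq_one ⟨_, hinv⟩ (Subtype.ext (mul_inv_cancel₀ hr0))⟩
  -- the integral closure `B` of `O_L` in `K`: finite over `O_L`, Dedekind, inside `O`
  set B := integralClosure OL K with hB
  haveI : Module.Finite OL B := IsIntegralClosure.finite OL L K B
  haveI : IsFractionRing B K := IsIntegralClosure.isFractionRing_of_finite_extension OL L K B
  haveI : IsDedekindDomain B := IsIntegralClosure.isDedekindDomain OL L K B
  have hBO : ∀ b : B, algebraMap B K b ∈ O := fun b => by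
    have hb : IsIntegral O (b : K) := (b.2 : IsIntegral OL (b : K)).tower_top
    obtain ⟨y, hy⟩ := IsIntegrallyClosed.isIntegral_iff.mp hb
    rw [show algebraMap B K b = (b : K) from rfl, ← hy]
    exact y.2
  let ιB : B →+* O := (algebraMap B K).codRestrict O hBO
  letI : Algebra B O := ιB.toAlgebra
  haveI : IsScalarTower B O K := IsScalarTower.of_algebraMap_eq fun _ => rfl
  haveI : IsScalarTower OL B O := IsScalarTower.of_algebraMap_eq fun _ => rfl
  -- the centre `𝔓`; `O = B_𝔓`
  set Q : Ideal B := (maximalIdeal O).comap (algebraMap B O) with hQdef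
  have hQ : ∀ b : B, b ∈ Q ↔ O.valuation (algebraMap B K b) < 1 := fun b => by
    rw [Ideal.mem_comap, ValuationSubring.valuation_lt_one_iff]
    rfl
  haveI : IsLocalization.AtPrime O Q :=
    isLocalization_atPrime_valuationSubring_of_isDedekindDomain O
  haveI : Algebra.EssFiniteType B O := Algebra.EssFiniteType.of_isLocalization O Q.primeCompl
  haveI : Algebra.EssFiniteType OL O := Algebra.EssFiniteType.comp OL B O
  -- the residue extension is separable: both residue fields are algebraic over the perfect `k`
  let kR : k →+* OL := (algebraMap k L).codRestrict OL fun c => show algebraMap L K _ ∈ O by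
    rw [← IsScalarTower.algebraMap_apply]; exact hk c
  letI : Algebra k OL := kR.toAlgebra
  letI : Algebra k O := ((algebraMap OL O).comp kR).toAlgebra
  haveI : IsScalarTower k OL O := IsScalarTower.of_algebraMap_eq fun _ => rfl
  haveI : IsScalarTower k O K :=
    IsScalarTower.of_algebraMap_eq fun c => IsScalarTower.algebraMap_apply k L K c
  haveI : Algebra.IsAlgebraic k (ResidueField O) := ⟨fun z => by
    obtain ⟨x, rfl⟩ := IsLocalRing.residue_surjective z
    obtain ⟨g, hg, hgx⟩ := hres x x.2
    refine ⟨g, hg.ne_zero, ?_⟩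
    rw [← ResidueField.algebraMap_eq, aeval_algebraMap_apply, ResidueField.algebraMap_eq,
      residue_eq_zero_iff, ValuationSubring.valuation_lt_one_iff]
    have e : ((aeval x g : O) : K) = aeval (x : K) g := (aeval_algebraMap_apply K x g).symm
    rwa [e]⟩
  haveI : Algebra.IsSeparable (ResidueField OL) (ResidueField O) :=
    Algebra.isSeparable_tower_top_of_isSeparable k _ _
  -- `𝔪_{O_L} O = 𝔪_O` (`e = 1`)
  have htO : algebraMap L K t ∈ O := (O.valuation_le_one_iff _).mp hlt.le
  have hmap : (maximalIdeal OL).map (algebraMap OL O) = maximalIdeal O := by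
    refine le_antisymm (((local_hom_TFAE (algebraMap OL O)).out 0 2).mp hloc) fun y hy => ?_
    rw [ValuationSubring.valuation_lt_one_iff] at hy
    have hyt := ht y hy
    by_cases ht0 : algebraMap L K t = 0
    · rw [ht0, Valuation.map_zero, le_zero_iff, Valuation.zero_iff] at hyt
      rw [show y = 0 from Subtype.ext hyt]
      exact zero_mem _
    · have hq : (y : K) / algebraMap L K t ∈ O := by
        rw [← O.valuation_le_one_iff, map_div₀]
        exact div_le_one_of_le₀ hyt zero_le
      have htmax : (⟨t, htO⟩ : OL) ∈ maximalIdeal OL := by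
        rw [mem_maximalIdeal, mem_nonunits_iff]
        exact fun hu => hlt.ne ((O.valuation_eq_one_iff _).mp (hu.map (algebraMap OL O)))
      have hy' : y = ⟨_, hq⟩ * algebraMap OL O ⟨t, htO⟩ :=
        Subtype.ext (div_mul_cancel₀ (y : K) ht0).symm
      rw [hy']
      exact Ideal.mul_mem_left _ _ (Ideal.mem_map_of_mem _ htmax)
  haveI : Algebra.FormallyUnramified OL O := Algebra.FormallyUnramified.of_map_maximalIdeal hmap
  haveI : Algebra.IsUnramifiedAt OL Q :=
    Algebra.FormallyUnramified.of_equiv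
      ((IsLocalization.algEquiv Q.primeCompl O (Localization.AtPrime Q)).restrictScalars OL)
  -- the Hensel root
  obtain ⟨η, hηO, hgen, f, hfm, hfη, hf'⟩ :=
    exists_henselRoot_of_isUnramifiedAt (R := OL) O hBO Q hQ
  refine ⟨η, hηO, ?_, f.map (algebraMap OL K), hfm.map _, fun i => ?_, ?_, ?_⟩
  · refine eq_top_iff.mpr (hgen ▸ Subfield.closure_mono (Set.union_subset_union_left _ ?_))
    rintro _ ⟨r, rfl⟩
    exact ⟨(r : L), rfl⟩
  · rw [coeff_map]
    exact ⟨(f.coeff i).2, (f.coeff i : L), rfl⟩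
  · rw [eval_map_algebraMap, hfη]
  · rw [derivative_map, eval_map_algebraMap, hf']

end Literature.AlgebraicGeometry.Resolution

end
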